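import Summits.KontsevichZagierPeriods.Zeta5Search.PolyReflect
import HarnessLib

/-!
# Reflection for trivariate polynomial data and module reduction by the kernel (cell `pub-zeta5`, certifier `cert-2`)

HONEST FRAMING: systematic search; no irrationality claim unless certified.

OUR infrastructure (Summit side). Extends P1's computable bivariate algebra `PolyReflect` (`Poly2`, `ev2`, `add2`, `mul2`, …,
kernel `decide`) by one variable, so that creative-telescoping certificates living in a holonomic MODULE
(brown9 levels 2–3: ttrl2 lane `zeta5-calc`, `run/shared/lean/ttrl/zeta5-calc/brown9/VIM.md` §7) can be replayed WITHOUT writing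
their reduction multipliers into the tree (the lane measured 0.8–23 M characters of cleared multipliers; the certificates
themselves are 25–135 K): the kernel performs the module reduction itself.

* `Poly3 = List Poly2`: dense integer polynomials in `(w, x, k)` (entry `j` = coefficient of `k^j`, a `Poly2` in `(w, x)`), with
  `ev3`, `add3`, `smul3`, `mul3`, `neg3`, `sub3`, `pow3`, `cst3`, `lin3` (`a·w + b·x + c·k + d`), `shift3` (`k ↦ k+1`), `substK`
  (`k := c(w,x)`), `subst3` (composition), `trim3` (drop trailing zeros), `isZero3`, and the evaluation lemmas.
The LINEAR layer (formal combinations of opaque symbols, fraction-free elimination and its soundness) is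
`Certificates/PolyReflectElim.lean`; size bounds and the fast packed kernel check are `PolyReflectNorm/Shadow/Pack`.
No mathematics specific to ζ(5) lives here.
-/

namespace Summit.KontsevichZagierPeriods.Zeta5Search.PolyReflect

/-! ### Trivariate dense polynomials: lists (in `k`) of bivariate polynomials (in `w, x`) -/

/-- Dense trivariate integer polynomials: the `j`-th entry is the coefficient of `k^j`, a `Poly2` in `(w, x)`. -/
abbrev Poly3 := List Poly2

/-- Evaluation at `(w, x, k)` (Horner in `k`). -/
def ev3 : Poly3 → ℚ → ℚ → ℚ → ℚ
  | [], _, _, _ => 0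
  | a :: p, w, x, k => ev2 a w x + k * ev3 p w x k

/-- Sum. -/
def add3 : Poly3 → Poly3 → Poly3
  | [], q => q
  | p, [] => p
  | a :: p, b :: q => add2 a b :: add3 p q

/-- Multiplication by a polynomial in `(w, x)` alone. -/
def smul3 (c : Poly2) : Poly3 → Poly3
  | [] => []
  | a :: p => mul2 c a :: smul3 c p

/-- Product. -/
def mul3 : Poly3 → Poly3 → Poly3
  | [], _ => []
  | a :: p, q => add3 (smul3 a q) ([] :: mul3 p q)

/-- Negation. -/
def neg3 (p : Poly3) : Poly3 := smul3 [[-1]] p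

/-- Difference. -/
def sub3 (p q : Poly3) : Poly3 := add3 p (neg3 q)

/-- Powers. -/
def pow3 (p : Poly3) : ℕ → Poly3
  | 0 => [[[1]]]
  | n + 1 => mul3 p (pow3 p n)

/-- The constant `c`. -/
def cst3 (c : ℤ) : Poly3 := [[[c]]]

/-- The linear form `a·w + b·x + c·k + d`. -/
def lin3 (a b c d : ℤ) : Poly3 := [[[d, a], [b]], [[c]]]

/-- The shift `k ↦ k + 1`. -/
def shift3 : Poly3 → Poly3
  | [] => []
  | a :: p => add3 [a] (mul3 (lin3 0 0 1 1) (shift3 p))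

/-- The substitution `k := c(w, x)` (result a `Poly2`). -/
def substK : Poly3 → Poly2 → Poly2
  | [], _ => []
  | a :: p, c => add2 a (mul2 c (substK p c))

/-- All stored coefficients vanish. -/
def isZero3 : Poly3 → Bool
  | [] => true
  | a :: p => isZero2 a && isZero3 p

/-- `ev3 [] = 0`. -/
@[simp] theorem ev3_nil (w x k : ℚ) : ev3 [] w x k = 0 := rfl
/-- `ev3` of a cons (Horner step in `k`). -/
@[simp] theorem ev3_cons (a : Poly2) (p : Poly3) (w x k : ℚ) : ev3 (a :: p) w x k = ev2 a w x + k * ev3 p w x k := rfl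

/-- `ev3` is additive. -/
theorem ev3_add3 : ∀ (p q : Poly3) (w x k : ℚ), ev3 (add3 p q) w x k = ev3 p w x k + ev3 q w x k
  | [], q, w, x, k => by simp [add3]
  | a :: p, [], w, x, k => by simp [add3]
  | a :: p, b :: q, w, x, k => by simp only [add3, ev3_cons, ev2_add2, ev3_add3 p q w x k]; ring

/-- `ev3` of a `(w,x)`-scalar multiple. -/
theorem ev3_smul3 (c : Poly2) : ∀ (p : Poly3) (w x k : ℚ), ev3 (smul3 c p) w x k = ev2 c w x * ev3 p w x k
  | [], w, x, k => by simp [smul3]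
  | a :: p, w, x, k => by simp only [smul3, ev3_cons, ev2_mul2, ev3_smul3 c p w x k]; ring

/-- `ev3` is multiplicative. -/
theorem ev3_mul3 : ∀ (p q : Poly3) (w x k : ℚ), ev3 (mul3 p q) w x k = ev3 p w x k * ev3 q w x k
  | [], q, w, x, k => by simp [mul3]
  | a :: p, q, w, x, k => by
    simp only [mul3, ev3_add3, ev3_smul3, ev3_cons, ev2_nil, ev3_mul3 p q w x k]; ring

/-- `ev3` of the negation. -/
theorem ev3_neg3 (p : Poly3) (w x k : ℚ) : ev3 (neg3 p) w x k = -ev3 p w x k := by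
  simp [neg3, ev3_smul3, ev2, ev1]

/-- `ev3` of the difference. -/
theorem ev3_sub3 (p q : Poly3) (w x k : ℚ) : ev3 (sub3 p q) w x k = ev3 p w x k - ev3 q w x k := by
  simp [sub3, ev3_add3, ev3_neg3]; ring

/-- `ev3` of a power. -/
theorem ev3_pow3 (p : Poly3) (w x k : ℚ) : ∀ n : ℕ, ev3 (pow3 p n) w x k = ev3 p w x k ^ n
  | 0 => by simp [pow3, ev2, ev1]
  | n + 1 => by rw [pow3, ev3_mul3, ev3_pow3 p w x k n]; ring

/-- `ev3` of a constant. -/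
@[simp] theorem ev3_cst3 (c : ℤ) (w x k : ℚ) : ev3 (cst3 c) w x k = (c : ℚ) := by
  simp [cst3, ev2, ev1]

/-- `ev3` of a linear form. -/
@[simp] theorem ev3_lin3 (a b c d : ℤ) (w x k : ℚ) :
    ev3 (lin3 a b c d) w x k = (a : ℚ) * w + (b : ℚ) * x + (c : ℚ) * k + (d : ℚ) := by
  simp [lin3, ev2, ev1]; ring

/-- `ev3` of the shift: `ev3 (shift3 p) w x k = ev3 p w x (k+1)`. -/
theorem ev3_shift3 : ∀ (p : Poly3) (w x k : ℚ), ev3 (shift3 p) w x k = ev3 p w x (k + 1)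
  | [], w, x, k => by simp [shift3]
  | a :: p, w, x, k => by
    rw [shift3, ev3_add3, ev3_mul3, ev3_shift3 p w x k, ev3_lin3]
    simp only [ev3_cons, ev3_nil]
    push_cast; ring

/-- `ev2` of the substitution `k := c`: `ev2 (substK p c) w x = ev3 p w x (ev2 c w x)`. -/
theorem ev2_substK : ∀ (p : Poly3) (c : Poly2) (w x : ℚ), ev2 (substK p c) w x = ev3 p w x (ev2 c w x)
  | [], c, w, x => by simp [substK]
  | a :: p, c, w, x => by rw [substK, ev2_add2, ev2_mul2, ev2_substK p c w x, ev3_cons]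

/-- Vanishing coefficients give the zero function. -/
theorem ev3_eq_zero_of_isZero3 : ∀ (p : Poly3) (w x k : ℚ), isZero3 p = true → ev3 p w x k = 0
  | [], w, x, k, _ => rfl
  | a :: p, w, x, k, h => by
    simp only [isZero3, Bool.and_eq_true] at h
    simp [ev2_eq_zero_of_isZero2 a w x h.1, ev3_eq_zero_of_isZero3 p w x k h.2]

/-- **Reflection principle**: `isZero3 (sub3 p q)` certifies `ev3 p = ev3 q`. -/
theorem ev3_eq_of_isZero3_sub3 (p q : Poly3) (h : isZero3 (sub3 p q) = true) (w x k : ℚ) :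
    ev3 p w x k = ev3 q w x k := by
  have := ev3_eq_zero_of_isZero3 _ w x k h
  rw [ev3_sub3] at this
  linarith

/-! ### Trimming trailing zeros (normal form for measuring degrees; values unchanged) -/

/-- Drop trailing zero coefficients. -/
def trim1 : List ℤ → List ℤ
  | [] => []
  | a :: p => if a = 0 ∧ trim1 p = [] then [] else a :: trim1 p

/-- Trim every row and drop trailing empty rows. -/
def trim2 : Poly2 → Poly2
  | [] => []
  | r :: p => if trim1 r = [] ∧ trim2 p = [] then [] else trim1 r :: trim2 p

/-- Trim every block and drop trailing empty blocks. -/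
def trim3 : Poly3 → Poly3
  | [] => []
  | b :: p => if trim2 b = [] ∧ trim3 p = [] then [] else trim2 b :: trim3 p

/-- Trimming does not change the value (level 1). -/
theorem ev1_trim1 : ∀ (p : List ℤ) (w : ℚ), ev1 (trim1 p) w = ev1 p w
  | [], w => rfl
  | a :: p, w => by
    have ih := ev1_trim1 p w
    unfold trim1
    split_ifs with h
    · rw [ev1_cons, ← ih, h.2, h.1]; simp
    · simp [ih]

/-- Trimming does not change the value (level 2). -/
theorem ev2_trim2 : ∀ (p : Poly2) (w x : ℚ), ev2 (trim2 p) w x = ev2 p w x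
  | [], w, x => rfl
  | r :: p, w, x => by
    have ih := ev2_trim2 p w x
    have hr := ev1_trim1 r w
    unfold trim2
    split_ifs with h
    · rw [ev2_cons, ← hr, ← ih, h.1, h.2]; simp
    · simp [ih, hr]

/-- Trimming does not change the value (level 3). -/
theorem ev3_trim3 : ∀ (p : Poly3) (w x k : ℚ), ev3 (trim3 p) w x k = ev3 p w x k
  | [], w, x, k => rfl
  | b :: p, w, x, k => by
    have ih := ev3_trim3 p w x k
    have hb := ev2_trim2 b w x
    unfold trim3
    split_ifs with h
    · rw [ev3_cons, ← hb, ← ih, h.1, h.2]; simp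
    · simp [ih, hb]

/-! ### Composition: a small polynomial in three "template" variables evaluated at `Poly3` arguments -/

/-- `Σ_i c_i N^i` for a coefficient list `c`. -/
def subst1 (N : Poly3) : List ℤ → Poly3
  | [] => []
  | a :: c => add3 (cst3 a) (mul3 N (subst1 N c))

/-- `Σ_j (subst1 N c_j) P^j`. -/
def subst2 (N P : Poly3) : Poly2 → Poly3
  | [] => []
  | a :: c => add3 (subst1 N a) (mul3 P (subst2 N P c))

/-- Composition `c(N, P, Q)` of a template `c` (a `Poly3` in three template variables) with `Poly3` arguments. -/
def subst3 (N P Q : Poly3) : Poly3 → Poly3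
  | [] => []
  | a :: c => add3 (subst2 N P a) (mul3 Q (subst3 N P Q c))

/-- `ev3` of `subst1`. -/
theorem ev3_subst1 (N : Poly3) (w x k : ℚ) : ∀ c : List ℤ, ev3 (subst1 N c) w x k = ev1 c (ev3 N w x k)
  | [] => by simp [subst1]
  | a :: c => by rw [subst1, ev3_add3, ev3_mul3, ev3_subst1 N w x k c, ev3_cst3, ev1_cons]

/-- `ev3` of `subst2`. -/
theorem ev3_subst2 (N P : Poly3) (w x k : ℚ) :
    ∀ c : Poly2, ev3 (subst2 N P c) w x k = ev2 c (ev3 N w x k) (ev3 P w x k)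
  | [] => by simp [subst2]
  | a :: c => by rw [subst2, ev3_add3, ev3_mul3, ev3_subst2 N P w x k c, ev3_subst1, ev2_cons]

/-- **`ev3` of a composition**: `ev3 (subst3 N P Q c) = ev3 c (ev3 N) (ev3 P) (ev3 Q)`. -/
theorem ev3_subst3 (N P Q : Poly3) (w x k : ℚ) :
    ∀ c : Poly3, ev3 (subst3 N P Q c) w x k = ev3 c (ev3 N w x k) (ev3 P w x k) (ev3 Q w x k)
  | [] => by simp [subst3]
  | a :: c => by rw [subst3, ev3_add3, ev3_mul3, ev3_subst3 N P Q w x k c, ev3_subst2, ev3_cons]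

end Summit.KontsevichZagierPeriods.Zeta5Search.PolyReflect
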